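import Literature.Computability.Cryptography.TM2ToWordRAM
import HarnessLib

/-!
# Multi-stack Turing machines on the word RAM, II: the step loop and runs

Continuation of `TM2ToWordRAM.lean` (the static-state compiler `Enc.comp` of one statement of a
multi-stack machine `Turing.TM2` into structured word-RAM code, `Enc.comp_exec`). This file closes
the loop over machine steps:

* `keyOps`, `Enc.stepCode E M` — one machine step: compute the dispatch key
  `lab l · sBase + st v` of the current (label, state) pair into register `7` and `switchL` over
  all pairs to the compiled statement `comp E (M l) v`; `Enc.stepCode_exec`;
* `Enc.simLoop E M = whilenz (label ≠ 0) stepCode` and **`Enc.simLoop_exec`**: a halting run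
  `c₀ → c₁ → ⋯ → cₙ` of `TM2.step M` (given as a chain `c : ℕ → Cfg`) is simulated from the memory
  of `c₀` to the memory of `cₙ` within `n · (stepCost + 2) + 1` word-RAM steps, `stepCost` a
  constant of the machine and the numbering — constant overhead per step (Papadimitriou 1994,
  §2.6);
* `chain_of_iterate_bind` — a `StateTransition`-style certificate
  `(flip bind f)^[n] (some a) = some b` unrolls into such a chain;
* the invariants along a chain: stacks stay in the working alphabet (`chain_mem`, from
  `TM2Sim.stepAux_stk_mem` of `TM2Window.lean`), heights grow by at most `TM2Comp.pushBound` per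
  step (`chain_length_le`, from `TM2Comp.length_stepAux_le` of `TimeBoundsProofs.lean`).

The numbering of a concrete `Turing.FinTM2`, the loader of the input stack and the end-to-end
run theorem are in `TM2ToWordRAMMachine.lean`.

## References

* C. H. Papadimitriou, *Computational Complexity*, Addison-Wesley 1994, §2.6 (random access
  machines; Turing machines are simulated by RAM programs with constant overhead).
* S. A. Cook, R. A. Reckhow, *Time bounded random access machines*, JCSS 7 (1973), §2.
* V. Vassilevska Williams, *On some fine-grained questions in algorithms and complexity*,
  Proc. ICM 2018, §2.
-/

namespace Literature.Computability.Cryptography.WordRAM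

open StateTransition Turing

/-! ## Unrolling a time certificate into a chain of configurations -/

/-- A certificate `(flip bind f)^[n] (some a) = some b` (as in `StateTransition.EvalsTo`)
unrolls into a chain `c 0 = a, f (c i) = some (c (i+1)) (i < n), c n = b`. [folklore] -/
theorem chain_of_iterate_bind {C : Type*} {f : C → Option C} :
    ∀ (n : ℕ) (a b : C), (flip bind f)^[n] (some a) = some b →
      ∃ c : ℕ → C, c 0 = a ∧ c n = b ∧ ∀ i, i < n → f (c i) = some (c (i + 1))
  | 0, a, b, h => ⟨fun _ => a, rfl, by simpa using h, fun i hi => absurd hi (Nat.not_lt_zero _)⟩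
  | n + 1, a, b, h => by
    rw [Function.iterate_succ_apply] at h
    cases ha : f a with
    | none =>
      exfalso
      have hnone : ∀ m : ℕ, (flip bind f)^[m] (none : Option C) = none := by
        intro m
        induction m with
        | zero => rfl
        | succ m ih => rw [Function.iterate_succ_apply]; exact ih
      have : (flip bind f (some a) : Option C) = none := by simp [flip, ha]
      rw [this, hnone] at h
      cases h
    | some a' =>
      have : (flip bind f (some a) : Option C) = some a' := by simp [flip, ha]
      rw [this] at h
      obtain ⟨c, hc0, hcn, hstep⟩ := chain_of_iterate_bind n a' b h
      refine ⟨fun i => Nat.casesOn i a c, rfl, hcn, fun i hi => ?_⟩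
      cases i with
      | zero => simpa [hc0] using ha
      | succ i => exact hstep i (by omega)

/-! ## Invariants along a chain of machine steps -/

namespace TM2Chain

variable {K : Type} {Γ : K → Type} {Λ : Type} {σ : Type} [DecidableEq K]

/-- A step from a configuration with a label runs the statement of that label; a halted
configuration has no successor. [folklore] -/
theorem step_eq_some_iff (M : Λ → TM2.Stmt Γ Λ σ) (c c' : TM2.Cfg Γ Λ σ) :
    TM2.step M c = some c' ↔ ∃ l, c.l = some l ∧ TM2.stepAux (M l) c.var c.stk = c' := by
  obtain ⟨_ | l, v, S⟩ := c
  · simp [TM2.step]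
  · simp [TM2.step]

/-- Along a chain of steps the stacks stay inside an alphabet family containing all symbols
pushable by the program (`TM2Sim.stepAux_stk_mem` iterated). [folklore] -/
theorem chain_mem {A : ∀ k, Set (Γ k)} (M : Λ → TM2.Stmt Γ Λ σ)
    (hM : ∀ l k γ, Complexity.TM2Sim.PushesSym (M l) k γ → γ ∈ A k)
    (c : ℕ → TM2.Cfg Γ Λ σ) (n : ℕ) (hc : ∀ i, i < n → TM2.step M (c i) = some (c (i + 1)))
    (h0 : ∀ k, ∀ a ∈ (c 0).stk k, a ∈ A k) :
    ∀ i, i ≤ n → ∀ k, ∀ a ∈ (c i).stk k, a ∈ A k := by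
  intro i
  induction i with
  | zero => exact fun _ => h0
  | succ i ih =>
    intro hi
    obtain ⟨l, -, hl⟩ := (step_eq_some_iff M _ _).1 (hc i (by omega))
    rw [← hl]
    exact Complexity.TM2Sim.stepAux_stk_mem (fun k γ => γ ∈ A k) (M l) (hM l) _ _ (ih (by omega))

/-- Along a chain of steps every stack grows by at most `D` per step, `D` a bound on the
`TM2Comp.pushBound` of the program (`TM2Comp.length_stepAux_le` iterated). [folklore] -/
theorem chain_length_le (M : Λ → TM2.Stmt Γ Λ σ) {D : ℕ}
    (hD : ∀ l, Complexity.TM2Comp.pushBound (M l) ≤ D)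
    (c : ℕ → TM2.Cfg Γ Λ σ) (n : ℕ) (hc : ∀ i, i < n → TM2.step M (c i) = some (c (i + 1))) :
    ∀ i, i ≤ n → ∀ k, ((c i).stk k).length ≤ ((c 0).stk k).length + i * D := by
  intro i
  induction i with
  | zero => simp
  | succ i ih =>
    intro hi k
    obtain ⟨l, -, hl⟩ := (step_eq_some_iff M _ _).1 (hc i (by omega))
    rw [← hl]
    have h1 := Complexity.TM2Comp.length_stepAux_le (M l) (c i).var (c i).stk k
    have h2 := ih (by omega) k
    have h3 := hD l
    rw [Nat.succ_mul]
    omega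

end TM2Chain

/-! ## One machine step: the dispatch on (label, state) -/

namespace SProg

/-- Compute the dispatch key `r7 := r2 * sBase + r3` of the current (label, state) pair. [folklore] -/
def keyOps (sBase : ℕ) : List OpSpec :=
  [(.mul, .dir 7, .dir 2, .imm sBase), (.add, .dir 7, .dir 7, .dir 3)]

/-- Semantics of `keyOps`. [folklore] -/
theorem key_exec {w : ℕ} {O : List ℕ → List ℕ} {R H : ℕ → ℕ} {sBase a b : ℕ} (h2 : R 2 = a)
    (h3 : R 3 = b) (hab : a * sBase + b < 2 ^ w) (qs : List (List ℕ)) :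
    Exec w O (block (keyOps sBase)) ⟨merge R H, qs⟩
      ⟨merge (Function.update R 7 (a * sBase + b)) H, qs⟩ 2 := by
  have hmul : a * sBase < 2 ^ w := by omega
  have key : ∀ Rf, execOps w (merge R H) (keyOps sBase) = Rf →
      Rf = merge (Function.update R 7 (a * sBase + b)) H := by
    intro Rf hR
    unfold keyOps at hR
    have htmp := execOps_cons_fwd hR; clear hR; obtain ⟨v1, hv1, hR⟩ := htmp
    simp -failIfUnchanged (disch := omega) only [Operand.write, Operand.read, merge_apply_of_lt,
      update_merge_of_lt,
      BinOp.eval_mul_of_lt, h2]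
      at hv1 hR
    have htmp := execOps_cons_fwd hR; clear hR; obtain ⟨v2, hv2, hR⟩ := htmp
    simp -failIfUnchanged (disch := omega) only [Operand.write, Operand.read, merge_apply_of_lt,
      Function.update_self, Function.update_of_ne, update_merge_of_lt,
      BinOp.eval_add_of_lt, h3, ← hv1]
      at hv2 hR
    simp only [execOps_nil] at hR; subst hR
    subst hv1 hv2
    rw [Function.update_idem]
  exact Exec.block' _ qs (key _ rfl)

/-- A switch over query-free bodies makes no oracle query. [folklore] -/
theorem switchL_queryFree : ∀ {cases : List (ℕ × SProg)}, (∀ cb ∈ cases, cb.2.QueryFree) →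
    (switchL cases).QueryFree
  | [], _ => trivial
  | cb :: r, h =>
    ⟨trivial, switchL_queryFree fun cb' h' => h cb' (List.mem_cons_of_mem _ h'), h cb (by simp)⟩

end SProg

namespace Enc

variable {K : Type} {Γ : K → Type} {Λ : Type} {σ : Type} (E : Enc K Γ Λ σ)

section defs

variable [Fintype Λ] [Fintype σ]

/-- All (label, state) pairs. [folklore] -/
noncomputable def pairs : List (Λ × σ) :=
  (Finset.univ : Finset Λ).toList ×ˢ (Finset.univ : Finset σ).toList

/-- **One machine step**: compute the dispatch key and switch over all (label, state) pairs to the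
statically compiled statements. [folklore] -/
noncomputable def stepCode (M : Λ → TM2.Stmt Γ Λ σ) : SProg :=
  .seq (.block (SProg.keyOps E.sBase))
    (SProg.switchL ((pairs : List (Λ × σ)).map fun lv => (E.key lv.1 lv.2, E.comp (M lv.1) lv.2)))

/-- **The simulation loop**: run machine steps while the label register is nonzero. [folklore] -/
noncomputable def simLoop (M : Λ → TM2.Stmt Γ Λ σ) : SProg :=
  .whilenz (.dir 2) (E.stepCode M)

/-- The largest cost of a compiled statement of the program. [folklore] -/
def maxCost (M : Λ → TM2.Stmt Γ Λ σ) : ℕ :=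
  (Finset.univ : Finset Λ).sup fun l => E.cost (M l)

/-- The word-RAM time of one simulated machine step. [folklore] -/
def stepCost (M : Λ → TM2.Stmt Γ Λ σ) : ℕ :=
  2 + (2 * (Fintype.card Λ * Fintype.card σ) + 1) + E.maxCost M

omit [Fintype σ] in
/-- `maxCost` bounds every `cost`. [folklore] -/
theorem cost_le_maxCost (M : Λ → TM2.Stmt Γ Λ σ) (l : Λ) : E.cost (M l) ≤ E.maxCost M :=
  Finset.le_sup (f := fun l => E.cost (M l)) (Finset.mem_univ l)

omit [Fintype Λ] [Fintype σ] in
/-- Compiled statements make no oracle query. [folklore] -/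
theorem comp_queryFree : ∀ (q : TM2.Stmt Γ Λ σ) (v : σ), (E.comp q v).QueryFree
  | .push k f q, v => ⟨SProg.block_queryFree _, comp_queryFree q v⟩
  | .peek k f q, v => by
    refine ⟨SProg.block_queryFree _, SProg.switchL_queryFree fun cb hcb => ?_⟩
    obtain ⟨c, -, rfl⟩ := List.mem_map.1 hcb
    exact comp_queryFree q _
  | .pop k f q, v => by
    refine ⟨SProg.block_queryFree _, SProg.switchL_queryFree fun cb hcb => ?_⟩
    obtain ⟨c, -, rfl⟩ := List.mem_map.1 hcb
    refine ⟨?_, comp_queryFree q _⟩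
    split
    · trivial
    · exact SProg.block_queryFree _
  | .load f q, v => comp_queryFree q (f v)
  | .branch p q₁ q₂, v => by
    simp only [comp]
    cases p v
    exacts [comp_queryFree q₂ v, comp_queryFree q₁ v]
  | .goto f, v => SProg.block_queryFree _
  | .halt, v => SProg.block_queryFree _

/-- `stepCode` makes no oracle query. [folklore] -/
theorem stepCode_queryFree (M : Λ → TM2.Stmt Γ Λ σ) : (E.stepCode M).QueryFree := by
  refine ⟨SProg.block_queryFree _, SProg.switchL_queryFree fun cb hcb => ?_⟩
  obtain ⟨lv, -, rfl⟩ := List.mem_map.1 hcb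
  exact comp_queryFree E _ _

/-- `simLoop` makes no oracle query. [folklore] -/
theorem simLoop_queryFree (M : Λ → TM2.Stmt Γ Λ σ) : (E.simLoop M).QueryFree :=
  stepCode_queryFree E M

/-- The number of (label, state) pairs. [folklore] -/
theorem length_pairs : (pairs : List (Λ × σ)).length = Fintype.card Λ * Fintype.card σ := by
  simp [pairs, List.length_product]

/-- Every pair is listed. [folklore] -/
theorem mem_pairs (l : Λ) (v : σ) : (l, v) ∈ (pairs : List (Λ × σ)) := by
  simp [pairs, List.mem_product]

end defs

variable {E}

/-- Dispatch keys separate (label, state) pairs. [folklore] -/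
theorem key_injective {A : ∀ k, Set (Γ k)} (hE : E.Good A) :
    Function.Injective fun lv : Λ × σ => E.key lv.1 lv.2 := by
  rintro ⟨l, v⟩ ⟨l', v'⟩ h
  simp only [key] at h
  have hv := hE.st_lt v
  have hv' := hE.st_lt v'
  have hB : 0 < E.sBase := by omega
  have h1 : E.st v = E.st v' := by
    have := congrArg (· % E.sBase) h
    simpa [Nat.mul_add_mod, Nat.mod_eq_of_lt hv, Nat.mod_eq_of_lt hv'] using this
  have h2 : E.lab l = E.lab l' := by
    have e1 : (E.lab l * E.sBase + E.st v) / E.sBase = E.lab l := by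
      rw [Nat.add_comm, Nat.add_mul_div_right _ _ hB, Nat.div_eq_of_lt hv, Nat.zero_add]
    have e2 : (E.lab l' * E.sBase + E.st v') / E.sBase = E.lab l' := by
      rw [Nat.add_comm, Nat.add_mul_div_right _ _ hB, Nat.div_eq_of_lt hv', Nat.zero_add]
    rw [← e1, ← e2, h]
  rw [hE.lab_inj h2, hE.st_inj h1]

/-- Dispatch keys fit below `(γΛ + 1) · sBase` for label codes `≤ γΛ`. [folklore] -/
theorem key_lt {A : ∀ k, Set (Γ k)} (hE : E.Good A) {B : ℕ} (hB : ∀ l, E.lab l ≤ B) (l : Λ) (v : σ) :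
    E.key l v < (B + 1) * E.sBase := by
  have h1 := Nat.mul_le_mul_right E.sBase (hB l)
  have h2 := hE.st_lt v
  simp only [key]
  rw [Nat.succ_mul]
  omega

/-- State codes fit in a word when the dispatch keys do. [folklore] -/
theorem st_lt_two_pow {A : ∀ k, Set (Γ k)} (hE : E.Good A) {w B : ℕ}
    (hkey : (B + 1) * E.sBase < 2 ^ w) (v : σ) : E.st v < 2 ^ w := by
  have := hE.st_lt v
  have h1 : E.sBase ≤ (B + 1) * E.sBase := Nat.le_mul_of_pos_left _ (by omega)
  omega

/-- Label codes fit in a word when the dispatch keys do. [folklore] -/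
theorem lab_lt_two_pow {A : ∀ k, Set (Γ k)} (hE : E.Good A) {w B : ℕ} (hB : ∀ l, E.lab l ≤ B)
    (hkey : (B + 1) * E.sBase < 2 ^ w) (l : Λ) : E.lab l < 2 ^ w := by
  have h0 := hE.sBase_pos
  have h1 : E.lab l ≤ E.lab l * E.sBase := Nat.le_mul_of_pos_right _ h0
  have h2 : E.lab l * E.sBase ≤ B * E.sBase := Nat.mul_le_mul_right _ (hB l)
  have h3 : B * E.sBase < (B + 1) * E.sBase := by rw [Nat.succ_mul]; omega
  omega

section run

variable [DecidableEq K] [Fintype Λ] [Fintype σ]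

omit [DecidableEq K] in
omit [DecidableEq K] in
/-- The keys of the dispatch table are distinct. [folklore] -/
theorem nodup_keys_pairs {A : ∀ k, Set (Γ k)} (hE : E.Good A) (M : Λ → TM2.Stmt Γ Λ σ) :
    (((pairs : List (Λ × σ)).map fun lv => (E.key lv.1 lv.2, E.comp (M lv.1) lv.2)).map
      Prod.fst).Nodup := by
  rw [List.map_map]
  have hp : (pairs : List (Λ × σ)).Nodup :=
    (Finset.nodup_toList _).product (Finset.nodup_toList _)
  exact hp.map (key_injective hE)

/-- **One simulated step.** From the memory of stacks `S` with the codes of `l`, `v` in registers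
`2`, `3` (and `Q` in `4`), `stepCode` reaches the memory of `TM2.stepAux (M l) v S` with the codes
of the new label and state, within `stepCost` steps. [folklore] -/
theorem stepCode_exec {A : ∀ k, Set (Γ k)} (hE : E.Good A) {w : ℕ} {O : List ℕ → List ℕ} {Q : ℕ}
    (hQ : 100 ≤ Q) (G : ℕ → ℕ) (qs : List (List ℕ)) {Hb : ℕ} (hw : cellAddr Q E.κ E.κ Hb < 2 ^ w)
    (hγ : E.γ < 2 ^ w) {B : ℕ} (hB : ∀ l, E.lab l ≤ B) (hkey : (B + 1) * E.sBase < 2 ^ w)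
    (M : Λ → TM2.Stmt Γ Λ σ) (hM : ∀ l k γ, Complexity.TM2Sim.PushesSym (M l) k γ → γ ∈ A k)
    (l : Λ) (v : σ) (S : ∀ k, List (Γ k)) (hS : ∀ k, ∀ a ∈ S k, a ∈ A k)
    (hlen : ∀ k, (S k).length + Complexity.TM2Comp.pushBound (M l) ≤ Hb) (R : ℕ → ℕ)
    (h2 : R 2 = E.lab l)
    (h3 : R 3 = E.st v) (h4 : R 4 = Q) :
    ∃ (R' : ℕ → ℕ) (t : ℕ),
      SProg.Exec w O (E.stepCode M) ⟨merge R (dataMem G Q E.κ (E.stk S)), qs⟩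
        ⟨merge R' (dataMem G Q E.κ (E.stk (TM2.stepAux (M l) v S).stk)), qs⟩ t ∧
      t ≤ E.stepCost M ∧ R' 4 = Q ∧ R' 2 = E.labCode (TM2.stepAux (M l) v S).l ∧
      R' 3 = E.st (TM2.stepAux (M l) v S).var := by
  have hk : E.key l v < 2 ^ w := (key_lt hE hB l v).trans hkey
  have h1 := SProg.key_exec (O := O) (H := dataMem G Q E.κ (E.stk S)) (sBase := E.sBase) h2 h3 hk qs
  obtain ⟨R', tb, hb, htb, h4', h2', h3'⟩ := comp_exec E hE hQ G qs hw hγ (st_lt_two_pow hE hkey)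
    (lab_lt_two_pow hE hB hkey) (M l) v S (hM l) hS hlen
    (Function.update (Function.update R 7 (E.lab l * E.sBase + E.st v)) 6 1) (by simp [h4])
  have hmem : (E.key l v, E.comp (M l) v) ∈
      (pairs : List (Λ × σ)).map fun lv => (E.key lv.1 lv.2, E.comp (M lv.1) lv.2) :=
    List.mem_map.2 ⟨(l, v), mem_pairs l v, rfl⟩
  obtain ⟨t', ht', hsw⟩ := SProg.switchL_exec hmem (nodup_keys_pairs hE M) (by simp [key]) hb
  refine ⟨R', 2 + t', SProg.Exec.seq h1 hsw, ?_, h4', h2', h3'⟩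
  have := cost_le_maxCost E M l
  simp only [stepCost, List.length_map, length_pairs] at ht' ⊢
  omega

/-- **The simulation loop on a halting run.** Let `c 0 → c 1 → ⋯ → c n` be a chain of steps of
the program `M` ending in a halted configuration, with stacks over the alphabet `A` and heights
leaving room for `n · D` pushes (`D` a bound on the `TM2Comp.pushBound`s of the program) below the
bound `Hb` that fits in a word. From the memory
of `c 0` with the codes of its label and state in registers `2`, `3`, the loop `simLoop` reaches
the memory of `c n` (label register `0`, state register the final state) within
`n · (stepCost + 2) + 1` steps. [folklore] -/
theorem simLoop_exec {A : ∀ k, Set (Γ k)} (hE : E.Good A) {w : ℕ} {O : List ℕ → List ℕ} {Q : ℕ}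
    (hQ : 100 ≤ Q) (G : ℕ → ℕ) (qs : List (List ℕ)) {Hb : ℕ} (hw : cellAddr Q E.κ E.κ Hb < 2 ^ w)
    (hγ : E.γ < 2 ^ w) {B : ℕ} (hB : ∀ l, E.lab l ≤ B) (hkey : (B + 1) * E.sBase < 2 ^ w)
    (M : Λ → TM2.Stmt Γ Λ σ) (hM : ∀ l k γ, Complexity.TM2Sim.PushesSym (M l) k γ → γ ∈ A k)
    {D : ℕ} (hD : ∀ l, Complexity.TM2Comp.pushBound (M l) ≤ D) (c : ℕ → TM2.Cfg Γ Λ σ) (n : ℕ)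
    (hc : ∀ i, i < n → TM2.step M (c i) = some (c (i + 1))) (hn : (c n).l = none)
    (h0 : ∀ k, ∀ a ∈ (c 0).stk k, a ∈ A k)
    (hHb : ∀ k, ((c 0).stk k).length + n * D ≤ Hb) (R : ℕ → ℕ)
    (h2 : R 2 = E.labCode (c 0).l) (h3 : R 3 = E.st (c 0).var) (h4 : R 4 = Q) :
    ∃ R' : ℕ → ℕ,
      SProg.ExecLE w O (E.simLoop M) ⟨merge R (dataMem G Q E.κ (E.stk (c 0).stk)), qs⟩
        ⟨merge R' (dataMem G Q E.κ (E.stk (c n).stk)), qs⟩ (n * (E.stepCost M + 2) + 1) ∧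
      R' 2 = 0 ∧ R' 3 = E.st (c n).var ∧ R' 4 = Q := by
  set Inv : ℕ → Store → Prop := fun i st => ∃ R : ℕ → ℕ,
    st = ⟨merge R (dataMem G Q E.κ (E.stk (c i).stk)), qs⟩ ∧ R 2 = E.labCode (c i).l ∧
      R 3 = E.st (c i).var ∧ R 4 = Q with hInv
  have hmem := TM2Chain.chain_mem M hM c n hc h0
  have hlen := TM2Chain.chain_length_le M hD c n hc
  have hbody : ∀ i, i < n → ∀ st, Inv i st → (Operand.dir 2).read st.mem ≠ 0 ∧
      ∃ st', SProg.ExecLE w O (E.stepCode M) st st' (E.stepCost M) ∧ Inv (i + 1) st' := by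
    intro i hi st hst
    obtain ⟨R, rfl, hR2, hR3, hR4⟩ := hst
    obtain ⟨l, hl, hstep⟩ := (TM2Chain.step_eq_some_iff M _ _).1 (hc i hi)
    rw [hl] at hR2
    refine ⟨?_, ?_⟩
    · have := hE.lab_pos l
      simp only [Operand.read_dir_merge (show 2 < 100 by decide), hR2, labCode]
      omega
    · have hlen' : ∀ k, ((c i).stk k).length + Complexity.TM2Comp.pushBound (M l) ≤ Hb := by
        intro k
        have h1 := hlen i hi.le k
        have h2 := hD l
        have h3 := hHb k
        have h4 : i * D + D ≤ n * D := by
          rw [← Nat.succ_mul]; exact Nat.mul_le_mul_right _ hi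
        omega
      obtain ⟨R', t, hex, ht, h4', h2', h3'⟩ := stepCode_exec hE hQ G qs hw hγ hB hkey M hM l
        (c i).var (c i).stk (hmem i hi.le) hlen' R hR2 hR3 hR4
      rw [hstep] at hex h2' h3'
      exact ⟨_, ⟨t, ht, hex⟩, R', rfl, h2', h3', h4'⟩
  have hexit : ∀ st, Inv n st → (Operand.dir 2).read st.mem = 0 := by
    intro st hst
    obtain ⟨R, rfl, hR2, -, -⟩ := hst
    rw [hn] at hR2
    simpa [Operand.read_dir_merge (show 2 < 100 by decide), labCode] using hR2
  obtain ⟨st', hex, R', rfl, h2', h3', h4'⟩ :=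
    SProg.ExecLE.whilenz_invariant n (E.stepCost M) Inv hbody hexit ⟨R, rfl, h2, h3, h4⟩
  rw [hn] at h2'
  exact ⟨R', hex, h2', h3', h4'⟩

end run

end Enc

end Literature.Computability.Cryptography.WordRAM
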